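import Mathlib
import Literature.MathematicalPhysics.QuantumManyBody.GroundStateFeynmanKacCutLine

-- Publication copy of the ideator's Sketch.lean: the route-file import is dropped (the farm build of the route
-- module was momentarily incoherent at publication time); nothing below uses route declarations.

/-!
# Crux `LandscapeBound` (stmt-AtomisticToContinuum-9087) — ideator 1, round 1: first lemmas

Scratch file of planner-cruxidea-stmt-AtomisticToContinuum-9087-1-0 (crux-ideate). Two idea cards:

* `sibling-telescoping-chaining` — exact dyadic telescoping of the slice participation ratio
  `R = r̄ · ∏ ⟨σ⟩_j` and a polynomial-Hölder chaining lemma turning per-octave sub-exponential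
  tilt tails with variance proxy `η·4^{-k}` into a uniform moment bound (`oneStepSplit`,
  `chainingMoment`).
* `palm-wake-gauge` — size-bias the second replica into the Palm wake of the first and close with
  Khas'minskii's gauge lemma (`khasminskii`).

Nothing here is a route item; statements only need to elaborate (sorries allowed in this folder).
-/

noncomputable section

open MeasureTheory Filter Finset
open scoped ENNReal NNReal BigOperators Topology

namespace Summit.AtomisticToContinuum.BoseEinsteinCondensation.Cruxes.LandscapeBound.Ideator1

open Literature.MathematicalPhysics.QuantumManyBody.BoseGas

/-! ## Card `sibling-telescoping-chaining` -/

/-- ONE-STEP SPLIT (the atom of the telescoping identity; route two-layer plan (b) made exact):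
for block `L¹`-masses `a i > 0` and block `L²`-masses `m i` of a nonnegative slice over the
`M = card ι` equal-volume cells of a box of volume `V`,
`V·(Σ m)/(Σ a)² = [M·Σ a²/(Σ a)²] · [Σ_i a_i²·r_i / Σ_i a_i²]`, `r_i = (V/M)·m_i/a_i²`
(coarse participation of the block masses × `a²`-weighted mean of the within-block
participations). Iterated over the dyadic tree this gives `R = r̄_{j₀} · ∏_{j<j₀} ⟨σ⟩_j` with
`⟨σ⟩_j` the `a_Q²`-weighted mean of the SIBLING participations `σ_Q = 8Σ_{c⊂Q}a_c²/(Σ_c a_c)²`.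
[folklore] -/
theorem oneStepSplit {ι : Type*} [Fintype ι] [Nonempty ι] (V : ℝ) (a m : ι → ℝ)
    (ha : ∀ i, 0 < a i) :
    V * (∑ i, m i) / (∑ i, a i) ^ 2 =
      ((Fintype.card ι : ℝ) * (∑ i, a i ^ 2) / (∑ i, a i) ^ 2) *
        ((∑ i, a i ^ 2 * ((V / Fintype.card ι) * m i / a i ^ 2)) / ∑ i, a i ^ 2) := by
  classical
  have hM : (Fintype.card ι : ℝ) ≠ 0 := by exact_mod_cast Fintype.card_ne_zero
  have ha2 : (∑ i, a i ^ 2) ≠ 0 :=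
    (Finset.sum_pos (fun i _ => pow_pos (ha i) 2) Finset.univ_nonempty).ne'
  have hsum : ∑ i, a i ^ 2 * ((V / Fintype.card ι) * m i / a i ^ 2) =
      (V / Fintype.card ι) * ∑ i, m i := by
    rw [Finset.mul_sum]
    refine Finset.sum_congr rfl fun i _ => ?_
    have hai : a i ≠ 0 := (ha i).ne'
    field_simp
  rw [hsum]
  field_simp

/-- SIBLING PARTICIPATION of a family of `8` child masses: `σ = 8·Σ a_c² / (Σ a_c)² ∈ [1, 8]`;
the lower bound is Cauchy–Schwarz. [folklore] -/
theorem one_le_siblingParticipation (a : Fin 8 → ℝ) (ha : ∀ c, 0 < a c) :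
    1 ≤ 8 * (∑ c, a c ^ 2) / (∑ c, a c) ^ 2 := by
  have hpos : 0 < (∑ c, a c) ^ 2 := pow_pos (Finset.sum_pos (fun c _ => ha c) univ_nonempty) 2
  rw [le_div_iff₀ hpos, one_mul]
  -- (Σ a)² ≤ card · Σ a² (Cauchy–Schwarz / `sq_sum_le_card_mul_sum_sq`)
  have h := sq_sum_le_card_mul_sum_sq (s := (univ : Finset (Fin 8))) (f := a)
  simpa using h

/-- Hölder exponent at octave `k` above the UV scale: `λ_k = q·(π²/6)·(k+1)²`, the reciprocal of
the summable weight `θ_k = 6/(π²(k+1)²)` (`Σ_k θ_k = 1`). [folklore] -/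
def holderExponent (q : ℝ) (k : ℕ) : ℝ := q * (Real.pi ^ 2 / 6) * ((k : ℝ) + 1) ^ 2

/-- Basel partial sums. -/
theorem sum_inv_sq_le (K : ℕ) : ∑ k ∈ range K, (1 : ℝ) / ((k : ℝ) + 1) ^ 2 ≤ Real.pi ^ 2 / 6 := by
  have h := hasSum_zeta_two
  -- reindex k ↦ k+1
  have h2 : ∑ k ∈ range K, (1 : ℝ) / ((k : ℝ) + 1) ^ 2 = ∑ n ∈ Finset.Ico 1 (K + 1), (1 : ℝ) / (n : ℝ) ^ 2 := by
    rw [Finset.range_eq_Ico, ← Finset.sum_Ico_add' (fun n : ℕ => (1:ℝ) / (n : ℝ) ^ 2) 0 K 1]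
    refine Finset.sum_congr rfl fun k _ => ?_
    push_cast
    ring
  rw [h2]
  refine sum_le_hasSum _ (fun n _ => by positivity) h

theorem sum_geom_four_le (K : ℕ) : ∑ k ∈ range K, ((4 : ℝ)⁻¹) ^ k ≤ 4 / 3 := by
  have h : ∑ k ∈ range K, ((4 : ℝ)⁻¹) ^ k = ((4:ℝ)⁻¹ ^ K - 1) / (4⁻¹ - 1) :=
    geom_sum_eq (x := (4:ℝ)⁻¹) (by norm_num) K
  rw [h, div_le_iff_of_neg (by norm_num)]
  have : (0:ℝ) ≤ (4:ℝ)⁻¹ ^ K := by positivity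
  linarith

theorem sum_sq_geom_four_eq (K : ℕ) :
    ∑ k ∈ range K, ((k : ℝ) + 1) ^ 2 * ((4 : ℝ)⁻¹) ^ k =
      80 / 27 - 4 / 27 * (9 * (K : ℝ) ^ 2 + 24 * K + 20) * ((4 : ℝ)⁻¹) ^ K := by
  induction K with
  | zero => simp; norm_num
  | succ K ih =>
    rw [Finset.sum_range_succ, ih, pow_succ]
    push_cast
    ring

theorem sum_sq_geom_four_le (K : ℕ) :
    ∑ k ∈ range K, ((k : ℝ) + 1) ^ 2 * ((4 : ℝ)⁻¹) ^ k ≤ 80 / 27 := by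
  rw [sum_sq_geom_four_eq]
  have : (0:ℝ) ≤ 4 / 27 * (9 * (K : ℝ) ^ 2 + 24 * K + 20) * ((4 : ℝ)⁻¹) ^ K := by positivity
  linarith

/-- CHAINING WITH POLYNOMIAL HÖLDER WEIGHTS (the engine of card `sibling-telescoping-chaining`).
`X k ≥ 0` is the level-`k` sibling-participation excess `⟨σ⟩_k − 1` (`k` = octaves above the UV
scale, so the physical variance proxy `η_k = η·4^{-k}` DECAYS with `k`: `η ≍ √(ρa³)`,
`η_k ≍ √(ρa³)(ξ/ℓ_k)²`). If each level has the sub-exponential moment bound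
`E e^{λ_k X_k} ≤ exp(η_k(λ_k + λ_k²))` AT the single exponent `λ_k = holderExponent q k`, then the
`q`-th moment of the telescoped product is bounded UNIFORMLY IN THE NUMBER OF LEVELS `K`:
`E[(∏_k (1 + X_k))^q] ≤ exp((4/3)qη + (40π²/81)q²η)` (generalised Hölder with weights
`θ_k = 6/(π²(k+1)²)`, `1 + x ≤ eˣ`, `Σ 4^{-k} = 4/3`, `Σ (k+1)²4^{-k} = 80/27`). Geometric Hölder
weights would instead produce the spurious factor `(L/ξ)^{c√(ρa³)}`. [folklore] -/
theorem chainingMoment {Ω : Type*} [MeasurableSpace Ω] (μ : Measure Ω) [IsProbabilityMeasure μ]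
    {K : ℕ} (X : Fin K → Ω → ℝ) (hXm : ∀ k, Measurable (X k)) (hX0 : ∀ k ω, 0 ≤ X k ω)
    {q η : ℝ} (hq : 1 ≤ q) (hη : 0 ≤ η)
    (hmgf : ∀ k : Fin K,
      ∫⁻ ω, ENNReal.ofReal (Real.exp (holderExponent q k * X k ω)) ∂μ ≤
        ENNReal.ofReal (Real.exp (η * 4⁻¹ ^ (k : ℕ) *
          (holderExponent q k + holderExponent q k ^ 2)))) :
    ∫⁻ ω, ENNReal.ofReal ((∏ k, (1 + X k ω)) ^ q) ∂μ ≤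
      ENNReal.ofReal (Real.exp ((4 / 3 + 40 * Real.pi ^ 2 / 81 * q) * q * η)) := by
  have hq0 : 0 < q := by linarith
  have hpi : 0 < Real.pi ^ 2 / 6 := by positivity
  -- weights θ_k = q / λ_k = 6/(π²(k+1)²)
  set θ : Fin K → ℝ := fun k => 6 / (Real.pi ^ 2 * ((k : ℝ) + 1) ^ 2) with hθ
  have hθpos : ∀ k, 0 < θ k := fun k => by simp only [hθ]; positivity
  have hlam_pos : ∀ k : Fin K, 0 < holderExponent q k := fun k => by
    unfold holderExponent; positivity
  have hθlam : ∀ k : Fin K, θ k * holderExponent q k = q := fun k => by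
    simp only [hθ, holderExponent]
    field_simp
  -- Σ θ ≤ 1 (Basel)
  have hθsum : ∑ k, θ k ≤ 1 := by
    have h1 : ∑ k : Fin K, θ k = (6 / Real.pi ^ 2) * ∑ k ∈ range K, (1 : ℝ) / ((k : ℝ) + 1) ^ 2 := by
      rw [Finset.mul_sum, ← Fin.sum_univ_eq_sum_range (fun k => (6 / Real.pi ^ 2) * ((1 : ℝ) / ((k : ℝ) + 1) ^ 2)) K]
      refine Finset.sum_congr rfl fun k _ => ?_
      simp only [hθ]
      field_simp
    rw [h1]
    have h2 := sum_inv_sq_le K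
    have hpi2 : 0 < Real.pi ^ 2 := by positivity
    calc (6 / Real.pi ^ 2) * ∑ k ∈ range K, (1 : ℝ) / ((k : ℝ) + 1) ^ 2
        ≤ (6 / Real.pi ^ 2) * (Real.pi ^ 2 / 6) := by gcongr
      _ = 1 := by field_simp
  set θ0 : ℝ := 1 - ∑ k, θ k with hθ0
  have hθ0nn : 0 ≤ θ0 := by simp only [hθ0]; linarith
  -- the functions f_k = ofReal (exp (λ_k X_k))
  set f : Fin K → Ω → ℝ≥0∞ := fun k ω => ENNReal.ofReal (Real.exp (holderExponent q k * X k ω)) with hf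
  have hfm : ∀ k, Measurable (f k) := fun k => by
    simp only [hf]
    exact ENNReal.measurable_ofReal.comp (Real.measurable_exp.comp ((hXm k).const_mul _))
  -- pointwise bound: ofReal((∏(1+X))^q) ≤ 1^θ0 * ∏ f_k^θ_k
  have hpt : ∀ ω, ENNReal.ofReal ((∏ k, (1 + X k ω)) ^ q) ≤
      (fun _ => (1:ℝ≥0∞)) ω ^ θ0 * ∏ k, f k ω ^ θ k := by
    intro ω
    have hrhs : ∏ k, f k ω ^ θ k = ENNReal.ofReal (Real.exp (q * ∑ k, X k ω)) := by
      simp only [hf]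
      rw [Finset.mul_sum, Real.exp_sum, ENNReal.ofReal_prod_of_nonneg (fun k _ => (Real.exp_pos _).le)]
      refine Finset.prod_congr rfl fun k _ => ?_
      rw [ENNReal.ofReal_rpow_of_nonneg (Real.exp_pos _).le (hθpos k).le, ← Real.exp_mul]
      congr 1
      rw [mul_comm (holderExponent q k * X k ω) (θ k), ← mul_assoc, hθlam k]
    rw [hrhs, ENNReal.one_rpow, one_mul]
    apply ENNReal.ofReal_le_ofReal
    have hprod_nn : 0 ≤ ∏ k, (1 + X k ω) := Finset.prod_nonneg fun k _ => by linarith [hX0 k ω]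
    calc (∏ k, (1 + X k ω)) ^ q ≤ (∏ k, Real.exp (X k ω)) ^ q := by
            apply Real.rpow_le_rpow hprod_nn ?_ hq0.le
            exact Finset.prod_le_prod (fun k _ => by linarith [hX0 k ω])
              (fun k _ => by linarith [Real.add_one_le_exp (X k ω)])
      _ = Real.exp (q * ∑ k, X k ω) := by
            rw [← Real.exp_sum, ← Real.exp_mul, mul_comm]
  -- Hölder
  have hHolder : ∫⁻ ω, (fun _ => (1:ℝ≥0∞)) ω ^ θ0 * ∏ k, f k ω ^ θ k ∂μ ≤
      (∫⁻ ω, (fun _ => (1:ℝ≥0∞)) ω ∂μ) ^ θ0 * ∏ k, (∫⁻ ω, f k ω ∂μ) ^ θ k := by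
    refine ENNReal.lintegral_mul_prod_norm_pow_le univ measurable_const.aemeasurable
      (fun k _ => (hfm k).aemeasurable) θ0 ?_ hθ0nn (fun k _ => (hθpos k).le)
    simp only [hθ0]; ring
  have hone : (∫⁻ ω, (fun _ => (1:ℝ≥0∞)) ω ∂μ) ^ θ0 = 1 := by
    simp [lintegral_const, measure_univ]
  -- each factor
  have hfac : ∀ k : Fin K, (∫⁻ ω, f k ω ∂μ) ^ θ k ≤
      ENNReal.ofReal (Real.exp (η * 4⁻¹ ^ (k : ℕ) * (q + q * holderExponent q k))) := by
    intro k
    calc (∫⁻ ω, f k ω ∂μ) ^ θ k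
        ≤ (ENNReal.ofReal (Real.exp (η * 4⁻¹ ^ (k : ℕ) *
            (holderExponent q k + holderExponent q k ^ 2)))) ^ θ k := by
          gcongr
          exact hmgf k
      _ = ENNReal.ofReal (Real.exp (η * 4⁻¹ ^ (k : ℕ) * (q + q * holderExponent q k))) := by
          rw [ENNReal.ofReal_rpow_of_nonneg (Real.exp_pos _).le (hθpos k).le, ← Real.exp_mul]
          have := hθlam k
          have key : η * 4⁻¹ ^ (k : ℕ) * (holderExponent q k + holderExponent q k ^ 2) * θ k
              = η * 4⁻¹ ^ (k : ℕ) * (q + q * holderExponent q k) := by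
            calc η * 4⁻¹ ^ (k : ℕ) * (holderExponent q k + holderExponent q k ^ 2) * θ k
                = η * 4⁻¹ ^ (k : ℕ) * ((θ k * holderExponent q k)
                    + (θ k * holderExponent q k) * holderExponent q k) := by ring
              _ = η * 4⁻¹ ^ (k : ℕ) * (q + q * holderExponent q k) := by rw [this]
          rw [key]
  -- assemble
  calc ∫⁻ ω, ENNReal.ofReal ((∏ k, (1 + X k ω)) ^ q) ∂μ
      ≤ ∫⁻ ω, (fun _ => (1:ℝ≥0∞)) ω ^ θ0 * ∏ k, f k ω ^ θ k ∂μ := lintegral_mono hpt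
    _ ≤ (∫⁻ ω, (fun _ => (1:ℝ≥0∞)) ω ∂μ) ^ θ0 * ∏ k, (∫⁻ ω, f k ω ∂μ) ^ θ k := hHolder
    _ = ∏ k, (∫⁻ ω, f k ω ∂μ) ^ θ k := by rw [hone, one_mul]
    _ ≤ ∏ k : Fin K, ENNReal.ofReal (Real.exp (η * 4⁻¹ ^ (k : ℕ) * (q + q * holderExponent q k))) :=
        Finset.prod_le_prod (fun k _ => bot_le) (fun k _ => hfac k)
    _ = ENNReal.ofReal (Real.exp (∑ k : Fin K, η * 4⁻¹ ^ (k : ℕ) * (q + q * holderExponent q k))) := by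
        rw [Real.exp_sum, ENNReal.ofReal_prod_of_nonneg (fun k _ => (Real.exp_pos _).le)]
    _ ≤ ENNReal.ofReal (Real.exp ((4 / 3 + 40 * Real.pi ^ 2 / 81 * q) * q * η)) := by
        apply ENNReal.ofReal_le_ofReal
        apply Real.exp_le_exp.2
        -- Σ_k η4^{-k}(q + q·q(π²/6)(k+1)²) ≤ qη·4/3 + q²η(π²/6)(80/27)
        have hsplit : ∑ k : Fin K, η * 4⁻¹ ^ (k : ℕ) * (q + q * holderExponent q k)
            = q * η * ∑ k ∈ range K, ((4:ℝ)⁻¹) ^ k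
              + q ^ 2 * η * (Real.pi ^ 2 / 6) * ∑ k ∈ range K, ((k : ℝ) + 1) ^ 2 * ((4 : ℝ)⁻¹) ^ k := by
          rw [Finset.mul_sum, Finset.mul_sum, ← Finset.sum_add_distrib,
            ← Fin.sum_univ_eq_sum_range (fun k => q * η * ((4:ℝ)⁻¹) ^ k
              + q ^ 2 * η * (Real.pi ^ 2 / 6) * (((k : ℝ) + 1) ^ 2 * ((4 : ℝ)⁻¹) ^ k)) K]
          refine Finset.sum_congr rfl fun k _ => ?_
          simp only [holderExponent]
          ring
        rw [hsplit]
        have h1 := sum_geom_four_le K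
        have h2 := sum_sq_geom_four_le K
        have hqη : 0 ≤ q * η := by positivity
        have hq2η : 0 ≤ q ^ 2 * η * (Real.pi ^ 2 / 6) := by positivity
        calc q * η * ∑ k ∈ range K, ((4:ℝ)⁻¹) ^ k
              + q ^ 2 * η * (Real.pi ^ 2 / 6) * ∑ k ∈ range K, ((k : ℝ) + 1) ^ 2 * ((4 : ℝ)⁻¹) ^ k
            ≤ q * η * (4 / 3) + q ^ 2 * η * (Real.pi ^ 2 / 6) * (80 / 27) := by gcongr
          _ = (4 / 3 + 40 * Real.pi ^ 2 / 81 * q) * q * η := by ring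

/-! ## Card `palm-wake-gauge` -/

/-- KHAS'MINSKII'S LEMMA / the gauge bound (Portenko 1975; Aizenman–Simon 1982 Thm 1.2(iii);
Chung–Zhao 1995 Lemma 3.7), for ONE free world-line of the tree's Feynman–Kac model
(`worldLine`, `wienerPaths 1`: Brownian motion at speed 2 in `ℝ³`) and a TIME-DEPENDENT bounded
nonnegative potential `b` on the window `[0, T]` (the propagated Palm wake `8πa·|δρ(y,t)|` of the
card): if the expected remaining action from every space-time starting point `(x, s)` is `≤ α < 1`,
then `sup_x E_x exp(∫₀ᵀ b(B_u, u) du) ≤ (1 − α)⁻¹`. [cite: ChungZhao1995, Lemma 3.7] -/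
theorem khasminskii (b : Space → ℝ → ℝ≥0∞) (hb : Measurable (Function.uncurry b))
    (B : ℝ≥0) (hbB : ∀ y t, b y t ≤ B) (T : ℝ) (hT : 0 ≤ T) (α : ℝ≥0∞) (hα : α < 1)
    (h : ∀ (x : Config 1) (s : ℝ), 0 ≤ s → s ≤ T →
      ∫⁻ ω, (∫⁻ u in Set.Ioc (0 : ℝ) (T - s), b (worldLine x ω u.toNNReal 0) (s + u))
        ∂(wienerPaths 1) ≤ α) :
    ∀ x : Config 1,
      ∫⁻ ω, ENNReal.ofReal (Real.exp
          (∫⁻ u in Set.Ioc (0 : ℝ) T, b (worldLine x ω u.toNNReal 0) u).toReal)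
        ∂(wienerPaths 1) ≤ (1 - α)⁻¹ := by
  sorry

/-- THE WAKE GAUGE CONSTANT (calculus behind the card's cheapest falsifier): a unit-normalised
charge `Q` spread by the 3-D Poisson kernel at radius `c t + ξ` has central height
`Q/(π²(ct+ξ)³)`, and `∫₀^∞ dt/(ct+ξ)³ = 1/(2cξ²)`; hence the sup-norm gauge of the wake
`b = 8πa·Q·P_{ct+ξ}` is `α = 8πaQ/(2π²cξ²) = 4aQ/(πcξ²)`. Here only the time integral.
[folklore] -/
theorem wake_time_integral (c ξ : ℝ) (hc : 0 < c) (hξ : 0 < ξ) :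
    ∫ t in Set.Ioi (0 : ℝ), ((c * t + ξ) ^ 3)⁻¹ = (2 * c * ξ ^ 2)⁻¹ := by
  -- antiderivative F(t) = -(2c)⁻¹ · ((ct+ξ)(ct+ξ))⁻¹, F(∞) = 0, F(0) = -(2cξ²)⁻¹
  have hpos : ∀ t : ℝ, 0 ≤ t → 0 < c * t + ξ := fun t ht => by positivity
  set F : ℝ → ℝ := fun s => -(2 * c)⁻¹ * ((c * s + ξ) * (c * s + ξ))⁻¹ with hF
  have hderiv : ∀ t ∈ Set.Ioi (0 : ℝ), HasDerivAt F (((c * t + ξ) ^ 3)⁻¹) t := by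
    intro t ht
    have hct : c * t + ξ ≠ 0 := (hpos t (le_of_lt ht)).ne'
    have h1 : HasDerivAt (fun s : ℝ => c * s + ξ) c t := by
      simpa using ((hasDerivAt_id t).const_mul c).add_const ξ
    have h2 : HasDerivAt (fun s : ℝ => (c * s + ξ) * (c * s + ξ))
        (c * (c * t + ξ) + (c * t + ξ) * c) t := h1.mul h1
    have hne : (c * t + ξ) * (c * t + ξ) ≠ 0 := mul_ne_zero hct hct
    have h3 : HasDerivAt F
        (-(2 * c)⁻¹ * (-(c * (c * t + ξ) + (c * t + ξ) * c) / ((c * t + ξ) * (c * t + ξ)) ^ 2)) t :=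
      (h2.inv hne).const_mul (-(2 * c)⁻¹)
    refine h3.congr_deriv ?_
    have hcne : c ≠ 0 := hc.ne'
    field_simp
    ring
  have hcont : ContinuousWithinAt F (Set.Ici 0) 0 := by
    refine ContinuousAt.continuousWithinAt ?_
    have hne : (c * (0:ℝ) + ξ) * (c * (0:ℝ) + ξ) ≠ 0 :=
      mul_ne_zero (hpos 0 le_rfl).ne' (hpos 0 le_rfl).ne'
    refine ContinuousAt.mul continuousAt_const ?_
    refine ContinuousAt.inv₀ ?_ hne
    fun_prop
  have hlim : Tendsto F atTop (𝓝 0) := by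
    have h1 : Tendsto (fun s : ℝ => c * s + ξ) atTop atTop :=
      tendsto_atTop_add_const_right _ _ (Tendsto.const_mul_atTop hc tendsto_id)
    have h2 : Tendsto (fun s : ℝ => (c * s + ξ) * (c * s + ξ)) atTop atTop :=
      h1.atTop_mul_atTop₀ h1
    have h3 : Tendsto (fun s : ℝ => ((c * s + ξ) * (c * s + ξ))⁻¹) atTop (𝓝 0) :=
      h2.inv_tendsto_atTop
    simpa [hF] using h3.const_mul (-(2 * c)⁻¹)
  have hnonneg : ∀ t ∈ Set.Ioi (0 : ℝ), 0 ≤ ((c * t + ξ) ^ 3)⁻¹ :=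
    fun t ht => inv_nonneg.2 (pow_nonneg (hpos t (le_of_lt ht)).le 3)
  rw [integral_Ioi_of_hasDerivAt_of_nonneg hcont hderiv hnonneg hlim]
  have hξne : ξ ≠ 0 := hξ.ne'
  have hcne : c ≠ 0 := hc.ne'
  simp only [hF]
  field_simp
  ring

end Summit.AtomisticToContinuum.BoseEinsteinCondensation.Cruxes.LandscapeBound.Ideator1
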